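import Literature.Probability.RandomPlanarGeometry.HexSAWArmchairSecondOrder
import Literature.Probability.RandomPlanarGeometry.HexSAWArmchairSecondOrderLower
import Literature.Probability.RandomPlanarGeometry.HexSAWArmchairWallRateSqrtMonotone
import Mathlib.Analysis.Complex.ExponentialBounds
import HarnessLib

/-!
# Beaton's ROTATED (armchair) honeycomb surface: the contact-density deficit has COEFFICIENT ONE —
# `e^{2t} (1/2 − ρ^±_rot(t)) → 1`, i.e. `1/2 − ρ^±_rot(y) = y⁻² (1 + O(y^{−1/4}))`, without differentiability

Topic `Literature/Probability/RandomPlanarGeometry` (lane «pcv-sawmu», car «ARM-DENSITY-COEFFICIENT», a-p6 g16).  The armchair twin of the same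
seat's `HexSAWSurfaceWallDensityCoefficient.lean`.  Combines `HexSAWArmchairWallRateSqrtMonotone.lean` (a-p6 g13: the convex armchair free energy
`κ_rot(t) = log β_rot(eᵗ)` = `Arm.armFreeEnergy`, one-sided densities `ρ⁻_rot ≤ ρ⁺_rot`, `armRightDensity_le_slope`, `slope_le_armLeftDensity`)
with the second-order windows `HexSAWArmchairSecondOrder.lean` (`Arm.mul_armRate_sq_sub_le : y(β_rot² − y) ≤ 1 + 7655/√y`) and
`HexSAWArmchairSecondOrderLower.lean` (`Arm.mul_armRate_sq_sub_ge : 1 − 2/m − (2m+1)/y² ≤ y(β_rot² − y)`, every `m ≥ 2`; here `m = ⌈√y⌉`).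

The device.  `L(y) := log β_rot(y)² − log y = y⁻² + O(y^{−5/2})` from the two windows; a one-sided derivative of the convex `κ_rot` at `t`
is squeezed between the chords over `[t − h, t]` and `[t, t + h]`; the mesoscopic step `h = e^{−t/4} = y^{−1/4}` makes both the chord error
`O(h e^{−2t})` and the window error `O(e^{−5t/2}/h)` of order `e^{−9t/4} = o(e^{−2t})`.  (The zig-zag wall has an `O(y⁻³)` window and admits
`h = y^{−1/2}`; the armchair windows are `O(y^{−5/2})`, hence the quarter step.)  The companion «ARM-DENSITY-SECOND-ORDER» (a-p6 g15, banked)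
records the ORDER `Θ(e^{−2t})` with constants `1/8` and `9`.

Sources.  N. R. Beaton, J. Phys. A 47 (2014) 075003 = arXiv:1210.0274v3, §3.1 (pp. 10–14: `μ(y)`, log-convexity, the density paragraph p. 14).
E. J. Janse van Rensburg (OUP 2000), §3.3 (free energies, densities as derivatives; convexity).  N. Madras, G. Slade (1993), §1.2.

## What is proved (namespace `…SAW.HexBW.Arm`)

* §1 `two_mul_armFreeEnergy_eq`, `log_armRate_sq_sub_le` (`log β_rot² − log y ≤ 1/y² + 7655/(y²√y)`, `y ≥ 1`), `exists_nat_sqrt_window`,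
  `le_log_armRate_sq_sub` (`1/y² − 2/(y²√y) − 58614341/(y³√y) ≤ log β_rot² − log y`, `y ≥ 64`).
* §2 numerics for the quarter step; §3 ★★ `half_sub_armRightDensity_ge_coeff`, ★★ `half_sub_armLeftDensity_le_coeff` (windows
  `e^{−2t} ∓ K e^{−9t/4}`); §4 ★★★ **`tendsto_exp_mul_half_sub_armRightDensity : e^{2t}(1/2 − ρ⁺_rot(t)) → 1`**,
  ★★★ **`tendsto_exp_mul_half_sub_armLeftDensity`**, `isEquivalent_…`; §5 the same for Beaton's `μ(y)` densities is immediate above `y = 4`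
  (`HV.rotSurfaceMu_eq_armRate_of_four_le`) — not restated.

HONEST LABEL.  LANE THEOREM (S), OWN; NEW-IN-WRITING (modest): together with the zig-zag car, BOTH honeycomb wall orientations have surface-contact
density `1/2 − y⁻² (1 + o(1))` (print: first order only).  NOT CLAIMED: the next armchair term (the armchair third-order windows would give it),
constants, anything below `y = 64`.
-/

noncomputable section

open Filter Asymptotics
open _root_.Topology

namespace Literature.Probability.RandomPlanarGeometry.SAW.HexBW.Arm

variable {y : ℝ}

/-! ### §1  The logarithmic window `log β_rot(y)² − log y = y⁻² + O(y^{−5/2})` -/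

/-- `2κ_rot(t) = log β_rot(eᵗ)²`. [cite: Beaton2014RotatedHoneycomb, §3.1 (arXiv v3 p. 11: Proposition 7, log-convexity)] -/
theorem two_mul_armFreeEnergy_eq (t : ℝ) : 2 * armFreeEnergy t = Real.log (armRate (Real.exp t) ^ 2) := by
  rw [armFreeEnergy_apply, Real.log_pow]; norm_num

/-- **`log β_rot(y)² − log y ≤ 1/y² + 7655/(y²√y)`** (`y ≥ 1`; `log x ≤ x − 1` and ARM2's upper window).
[cite: Beaton2014RotatedHoneycomb, §3.1 (arXiv v3 pp. 10–12: Proposition 7)] -/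
theorem log_armRate_sq_sub_le (hy : 1 ≤ y) :
    Real.log (armRate y ^ 2) - Real.log y ≤ 1 / y ^ 2 + 7655 / (y ^ 2 * Real.sqrt y) := by
  have hy0 : 0 < y := by linarith
  have hs0 : 0 < Real.sqrt y := Real.sqrt_pos.2 hy0
  have hβ : 0 < armRate y ^ 2 := pow_pos (armRate_pos y) 2
  have hup := mul_armRate_sq_sub_le hy
  rw [← Real.log_div hβ.ne' hy0.ne']
  have h1 := Real.log_le_sub_one_of_pos (div_pos hβ hy0)
  have h2 : armRate y ^ 2 / y - 1 ≤ 1 / y ^ 2 + 7655 / (y ^ 2 * Real.sqrt y) := by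
    rw [div_sub_one hy0.ne', div_le_iff₀ hy0]
    have e : (1 / y ^ 2 + 7655 / (y ^ 2 * Real.sqrt y)) * y = (1 + 7655 / Real.sqrt y) / y := by field_simp
    rw [e, le_div_iff₀ hy0]
    linarith
  linarith

/-- A natural number `m` with `√y ≤ m ≤ √y + 1` and `m ≥ 2` (`y ≥ 4`). [cite: MadrasSlade1993, §1.2] -/
theorem exists_nat_sqrt_window (hy : 4 ≤ y) : ∃ m : ℕ, 2 ≤ m ∧ Real.sqrt y ≤ m ∧ (m : ℝ) ≤ Real.sqrt y + 1 := by
  refine ⟨⌈Real.sqrt y⌉₊, ?_, Nat.le_ceil _, ?_⟩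
  · have h2 : (2 : ℝ) ≤ Real.sqrt y := by
      rw [show (2 : ℝ) = Real.sqrt 4 by rw [show (4:ℝ) = 2 ^ 2 by norm_num, Real.sqrt_sq (by norm_num)]]
      exact Real.sqrt_le_sqrt hy
    have : (2 : ℝ) ≤ (⌈Real.sqrt y⌉₊ : ℝ) := h2.trans (Nat.le_ceil _)
    exact_mod_cast this
  · exact (Nat.ceil_lt_add_one (Real.sqrt_nonneg y)).le

/-- **`1/y² − 2/(y²√y) − 58614341/(y³√y) ≤ log β_rot(y)² − log y`** (`y ≥ 64`): ARM3's lower window at `m = ⌈√y⌉` gives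
`u := β_rot²/y − 1 ≥ (1 − 2/√y − (2√y+3)/y²)/y² ≥ 0`, and `log(1+u) ≥ u/(1+u) ≥ u − u² ≥ u − 7656²/y⁴`.
[cite: Beaton2014RotatedHoneycomb, §3.1 (arXiv v3 pp. 10–12: Proposition 7)] -/
theorem le_log_armRate_sq_sub (hy : 64 ≤ y) :
    1 / y ^ 2 - 2 / (y ^ 2 * Real.sqrt y) - 58614341 / (y ^ 3 * Real.sqrt y) ≤ Real.log (armRate y ^ 2) - Real.log y := by
  have hy0 : 0 < y := by linarith
  have hy1 : 1 ≤ y := by linarith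
  have hs0 : 0 < Real.sqrt y := Real.sqrt_pos.2 hy0
  have hs8 : 8 ≤ Real.sqrt y := by
    rw [show (8 : ℝ) = Real.sqrt 64 by rw [show (64:ℝ) = 8 ^ 2 by norm_num, Real.sqrt_sq (by norm_num)]]
    exact Real.sqrt_le_sqrt hy
  have hss : Real.sqrt y * Real.sqrt y = y := Real.mul_self_sqrt hy0.le
  have hβ : 0 < armRate y ^ 2 := pow_pos (armRate_pos y) 2
  obtain ⟨m, hm2, hms, hms1⟩ := exists_nat_sqrt_window (by linarith : (4 : ℝ) ≤ y)
  have hm0 : (0 : ℝ) < m := by exact_mod_cast (show 0 < m by omega)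
  have hlo := mul_armRate_sq_sub_ge hy1 hm2
  have hup := mul_armRate_sq_sub_le hy1
  -- `u = (β² − y)/y`
  set u : ℝ := armRate y ^ 2 / y - 1 with hu
  have huy : y * (armRate y ^ 2 - y) = u * y ^ 2 := by rw [hu]; field_simp
  rw [← Real.log_div hβ.ne' hy0.ne', show armRate y ^ 2 / y = 1 + u by rw [hu]; ring]
  -- bounds on `u`
  have hu_up : u ≤ 7656 / y ^ 2 := by
    have h1 : u * y ^ 2 ≤ 1 + 7655 / Real.sqrt y := by rw [← huy]; exact hup
    have h2 : 7655 / Real.sqrt y ≤ 7655 := by rw [div_le_iff₀ hs0]; nlinarith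
    rw [le_div_iff₀ (by positivity)]; linarith
  have hsy : Real.sqrt y ≤ y := by nlinarith [mul_nonneg (sub_nonneg.2 hs8) hs0.le, hss]
  have hu_lo : 1 / y ^ 2 - 2 / (y ^ 2 * Real.sqrt y) - 5 / (y ^ 3 * Real.sqrt y) ≤ u := by
    have h1 : 1 - 2 / (m : ℝ) - (2 * m + 1) / y ^ 2 ≤ u * y ^ 2 := by rw [← huy]; exact hlo
    have h2 : 2 / (m : ℝ) ≤ 2 / Real.sqrt y := div_le_div_of_nonneg_left (by norm_num) hs0 hms
    have h3 : (2 * (m : ℝ) + 1) / y ^ 2 ≤ 5 / (y * Real.sqrt y) := by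
      rw [div_le_div_iff₀ (by positivity) (by positivity)]
      have hpos : 0 ≤ y * Real.sqrt y := by positivity
      calc (2 * (m : ℝ) + 1) * (y * Real.sqrt y) ≤ (2 * Real.sqrt y + 3) * (y * Real.sqrt y) := by
              apply mul_le_mul_of_nonneg_right _ hpos; linarith
        _ = 2 * y * (Real.sqrt y * Real.sqrt y) + 3 * (y * Real.sqrt y) := by ring
        _ ≤ 5 * y ^ 2 := by rw [hss]; nlinarith [mul_le_mul_of_nonneg_left hsy hy0.le]
    have e1 : (1 / y ^ 2 - 2 / (y ^ 2 * Real.sqrt y) - 5 / (y ^ 3 * Real.sqrt y)) * y ^ 2 =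
        1 - 2 / Real.sqrt y - 5 / (y * Real.sqrt y) := by
      field_simp
    refine le_of_mul_le_mul_right ?_ (pow_pos hy0 2)
    rw [e1]; linarith
  have hyy : 512 ≤ y * Real.sqrt y := by nlinarith [mul_le_mul hy hs8 (by norm_num) hy0.le]
  have hu0 : 0 ≤ u := by
    have a : 2 / (y ^ 2 * Real.sqrt y) ≤ 1 / (4 * y ^ 2) := by
      rw [div_le_div_iff₀ (by positivity) (by positivity)]
      nlinarith [mul_le_mul_of_nonneg_left hs8 (pow_pos hy0 2).le]
    have b : 5 / (y ^ 3 * Real.sqrt y) ≤ 1 / (4 * y ^ 2) := by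
      rw [div_le_div_iff₀ (by positivity) (by positivity)]
      have e3 : y ^ 3 * Real.sqrt y = y ^ 2 * (y * Real.sqrt y) := by ring
      rw [e3]
      nlinarith [mul_le_mul_of_nonneg_left hyy (pow_pos hy0 2).le]
    have c : (0 : ℝ) < 1 / (4 * y ^ 2) := by positivity
    have d : 1 / y ^ 2 = 4 * (1 / (4 * y ^ 2)) := by field_simp
    linarith
  -- `log (1+u) ≥ u/(1+u) ≥ u − u²`
  have hlog : u - u ^ 2 ≤ Real.log (1 + u) := by
    have h1 := Real.one_sub_inv_le_log_of_pos (by linarith : (0 : ℝ) < 1 + u)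
    have h2 : u - u ^ 2 ≤ 1 - (1 + u)⁻¹ := by
      rw [show 1 - (1 + u)⁻¹ = u / (1 + u) by field_simp; ring, le_div_iff₀ (by linarith)]
      nlinarith [sq_nonneg u, mul_nonneg hu0 (sq_nonneg u)]
    linarith
  have hu2 : u ^ 2 ≤ 58614336 / (y ^ 3 * Real.sqrt y) := by
    calc u ^ 2 ≤ (7656 / y ^ 2) ^ 2 := pow_le_pow_left₀ hu0 hu_up 2
      _ = 58614336 / y ^ 4 := by rw [div_pow]; norm_num; ring
      _ ≤ 58614336 / (y ^ 3 * Real.sqrt y) := by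
          apply div_le_div_of_nonneg_left (by norm_num) (by positivity)
          calc y ^ 3 * Real.sqrt y ≤ y ^ 3 * y := mul_le_mul_of_nonneg_left hsy (pow_pos hy0 3).le
            _ = y ^ 4 := by ring
  have e : 58614341 / (y ^ 3 * Real.sqrt y) = 5 / (y ^ 3 * Real.sqrt y) + 58614336 / (y ^ 3 * Real.sqrt y) := by
    rw [← add_div]; norm_num
  rw [e]
  linarith


/-! ### §2  Pure-exponential form of the window and the numerics of the quarter step -/

/-- `√(eˣ) = e^{x/2}`, `(eˣ)²·√(eˣ) = e^{5x/2}`, `(eˣ)³·√(eˣ) = e^{7x/2}`, `1/(eˣ)² = e^{−2x}`. [cite: MadrasSlade1993, §1.2] -/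
theorem exp_sqrt_facts (x : ℝ) :
    Real.sqrt (Real.exp x) = Real.exp (x / 2) ∧ Real.exp x ^ 2 * Real.sqrt (Real.exp x) = Real.exp (5 * x / 2) ∧
      Real.exp x ^ 3 * Real.sqrt (Real.exp x) = Real.exp (7 * x / 2) ∧ 1 / Real.exp x ^ 2 = Real.exp (-(2 * x)) := by
  have h1 : Real.sqrt (Real.exp x) = Real.exp (x / 2) := by
    rw [show Real.exp x = Real.exp (x / 2) ^ 2 by rw [← Real.exp_nat_mul]; congr 1; push_cast; ring,
      Real.sqrt_sq (Real.exp_pos _).le]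
  refine ⟨h1, ?_, ?_, ?_⟩
  · rw [h1, ← Real.exp_nat_mul, ← Real.exp_add]; congr 1; push_cast; ring
  · rw [h1, ← Real.exp_nat_mul, ← Real.exp_add]; congr 1; push_cast; ring
  · rw [div_eq_iff (pow_pos (Real.exp_pos x) 2).ne', ← Real.exp_nat_mul, ← Real.exp_add,
      show -(2 * x) + ((2 : ℕ) : ℝ) * x = 0 by push_cast; ring, Real.exp_zero]

/-- The window in the variable `x = log y`, pure-exponential form: `log β_rot(eˣ)² − x ≤ e^{−2x} + 7655 e^{−5x/2}` (`x ≥ 0`).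
[cite: Beaton2014RotatedHoneycomb, §3.1 (arXiv v3 pp. 10–12: Proposition 7)] -/
theorem log_armRate_sq_exp_sub_le {x : ℝ} (hx : 0 ≤ x) :
    Real.log (armRate (Real.exp x) ^ 2) - x ≤ Real.exp (-(2 * x)) + 7655 * Real.exp (-(5 * x / 2)) := by
  obtain ⟨-, e5, -, e2⟩ := exp_sqrt_facts x
  have h := log_armRate_sq_sub_le (y := Real.exp x) (by simpa using Real.exp_le_exp.2 hx)
  rw [Real.log_exp, e5, e2, show (7655 : ℝ) / Real.exp (5 * x / 2) = 7655 * Real.exp (-(5 * x / 2)) by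
    rw [Real.exp_neg, div_eq_mul_inv]] at h
  exact h

/-- The window in the variable `x = log y`, pure-exponential form:
`e^{−2x} − 2 e^{−5x/2} − 58614341 e^{−7x/2} ≤ log β_rot(eˣ)² − x` (`x ≥ log 64`).
[cite: Beaton2014RotatedHoneycomb, §3.1 (arXiv v3 pp. 10–12: Proposition 7)] -/
theorem le_log_armRate_sq_exp_sub {x : ℝ} (hx : Real.log 64 ≤ x) :
    Real.exp (-(2 * x)) - 2 * Real.exp (-(5 * x / 2)) - 58614341 * Real.exp (-(7 * x / 2)) ≤
      Real.log (armRate (Real.exp x) ^ 2) - x := by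
  obtain ⟨-, e5, e7, e2⟩ := exp_sqrt_facts x
  have h64 : (64 : ℝ) ≤ Real.exp x := by
    have := Real.exp_le_exp.2 hx; rwa [Real.exp_log (by norm_num)] at this
  have h := le_log_armRate_sq_sub h64
  rw [Real.log_exp, e5, e7, e2, show (2 : ℝ) / Real.exp (5 * x / 2) = 2 * Real.exp (-(5 * x / 2)) by
    rw [Real.exp_neg, div_eq_mul_inv], show (58614341 : ℝ) / Real.exp (7 * x / 2) = 58614341 * Real.exp (-(7 * x / 2)) by
    rw [Real.exp_neg, div_eq_mul_inv]] at h
  exact h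

/-- The quarter step `h = e^{−t/4}` for `t ≥ log 64`: `0 < h ≤ ½`, `h⁴ = e^{−t} ≤ 1/64`, and the monomial dictionary
`e^{−5t/2} = e^{−2t} h²`, `e^{−7t/2} = e^{−2t} h⁶`, `e^{−9t/4} = e^{−2t} h`. [cite: MadrasSlade1993, §1.2] -/
theorem quarter_step_facts {t : ℝ} (ht : Real.log 64 ≤ t) :
    0 < Real.exp (-(t / 4)) ∧ Real.exp (-(t / 4)) ≤ 1 / 2 ∧ Real.exp (-(t / 4)) ^ 4 ≤ 1 / 64 ∧
      Real.exp (-(5 * t / 2)) = Real.exp (-(2 * t)) * Real.exp (-(t / 4)) ^ 2 ∧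
      Real.exp (-(7 * t / 2)) = Real.exp (-(2 * t)) * Real.exp (-(t / 4)) ^ 6 ∧
      Real.exp (-(9 * t / 4)) = Real.exp (-(2 * t)) * Real.exp (-(t / 4)) := by
  refine ⟨Real.exp_pos _, ?_, ?_, ?_, ?_, ?_⟩
  · have h16 : Real.log 16 ≤ t := (Real.log_le_log (by norm_num) (by norm_num)).trans ht
    have h4 : Real.log 16 = 4 * Real.log 2 := by
      rw [show (16 : ℝ) = 2 ^ 4 by norm_num, Real.log_pow]; norm_num
    calc Real.exp (-(t / 4)) ≤ Real.exp (-Real.log 2) := Real.exp_le_exp.2 (by linarith)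
      _ = 1 / 2 := by rw [Real.exp_neg, Real.exp_log (by norm_num)]; norm_num
  · rw [← Real.exp_nat_mul, show ((4 : ℕ) : ℝ) * (-(t / 4)) = -t by push_cast; ring]
    calc Real.exp (-t) ≤ Real.exp (-Real.log 64) := Real.exp_le_exp.2 (by linarith)
      _ = 1 / 64 := by rw [Real.exp_neg, Real.exp_log (by norm_num)]; norm_num
  · rw [← Real.exp_nat_mul, ← Real.exp_add]; congr 1; push_cast; ring
  · rw [← Real.exp_nat_mul, ← Real.exp_add]; congr 1; push_cast; ring
  · rw [← Real.exp_add]; congr 1; ring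

/-- Shifted windows at `x = t ± h` (`0 ≤ h ≤ ½`): `e^{−2(t+h)} ≤ e^{−2t}(1 − 2h + 4h²)`, `e^{−5(t+h)/2} ≤ e^{−5t/2}`,
`e^{−2(t−h)} ≤ e^{−2t}(1 + 2h + 4h²)`, `e^{−5(t−h)/2} ≤ 8 e^{−5t/2}`. [cite: MadrasSlade1993, §1.2] -/
theorem quarter_shift_facts (t h : ℝ) (hh0 : 0 ≤ h) (hh1 : h ≤ 1 / 2) :
    Real.exp (-(2 * (t + h))) ≤ Real.exp (-(2 * t)) * (1 - 2 * h + 4 * h ^ 2) ∧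
      Real.exp (-(5 * (t + h) / 2)) ≤ Real.exp (-(5 * t / 2)) ∧
      Real.exp (-(2 * (t - h))) ≤ Real.exp (-(2 * t)) * (1 + 2 * h + 4 * h ^ 2) ∧
      Real.exp (-(5 * (t - h) / 2)) ≤ 8 * Real.exp (-(5 * t / 2)) := by
  have hem : Real.exp (-(2 * h)) ≤ 1 - 2 * h + 4 * h ^ 2 := by
    have hx : |-(2 * h)| ≤ 1 := by rw [abs_neg, abs_of_nonneg (by linarith)]; linarith
    have := Real.abs_exp_sub_one_sub_id_le hx
    rw [abs_le] at this
    nlinarith [this.2]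
  have hep : Real.exp (2 * h) ≤ 1 + 2 * h + 4 * h ^ 2 := by
    have hx : |2 * h| ≤ 1 := by rw [abs_of_nonneg (by linarith)]; linarith
    have := Real.abs_exp_sub_one_sub_id_le hx
    rw [abs_le] at this
    nlinarith [this.2]
  have he8 : Real.exp (5 * h / 2) ≤ 8 := by
    have he := Real.exp_one_lt_d9
    calc Real.exp (5 * h / 2) ≤ Real.exp 2 := Real.exp_le_exp.2 (by linarith)
      _ = Real.exp 1 ^ 2 := by rw [← Real.exp_nat_mul]; norm_num
      _ ≤ 8 := by nlinarith [Real.exp_pos 1]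
  refine ⟨?_, Real.exp_le_exp.2 (by linarith), ?_, ?_⟩
  · rw [show -(2 * (t + h)) = -(2 * t) + -(2 * h) by ring, Real.exp_add]
    exact mul_le_mul_of_nonneg_left hem (Real.exp_pos _).le
  · rw [show -(2 * (t - h)) = -(2 * t) + 2 * h by ring, Real.exp_add]
    exact mul_le_mul_of_nonneg_left hep (Real.exp_pos _).le
  · rw [show -(5 * (t - h) / 2) = 5 * h / 2 + -(5 * t / 2) by ring, Real.exp_add]
    exact mul_le_mul_of_nonneg_right he8 (Real.exp_pos _).le

/-! ### §3  The two chords with the quarter step -/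

set_option maxHeartbeats 400000 in
/-- ★★ **`e^{−2t} − 461756·e^{−9t/4} ≤ 1/2 − ρ⁺_rot(t)` for `t ≥ log 64`**: `ρ⁺_rot(t)` is at most the slope of `κ_rot` over `[t, t + h]`,
`h = e^{−t/4}`, and `2(κ_rot(t+h) − κ_rot(t)) = L(t+h) − L(t) + h ≤ h − 2h e^{−2t} + 7661 h² e^{−2t} + 58614341 h⁶ e^{−2t}`
(`L(x) := log β_rot(eˣ)² − x`, §2). [cite: Beaton2014RotatedHoneycomb, §3.1 (arXiv v3 p. 11: log-convexity; p. 14: the density)] [cite: JansevanRensburg2000, §3.3 (densities as derivatives of the free energy)] -/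
theorem half_sub_armRightDensity_ge_coeff {t : ℝ} (ht : Real.log 64 ≤ t) :
    Real.exp (-(2 * t)) - 461756 * Real.exp (-(9 * t / 4)) ≤ 1 / 2 - armRightDensity t := by
  obtain ⟨hh0, hh1, hh4, e5, e7, e9⟩ := quarter_step_facts ht
  obtain ⟨s2, s5, -, -⟩ := quarter_shift_facts t (Real.exp (-(t / 4))) hh0.le hh1
  have hE : 0 < Real.exp (-(2 * t)) := Real.exp_pos _
  have ht0 : 0 ≤ t := (Real.log_nonneg (by norm_num)).trans ht
  -- the chord
  have hlt : t < t + Real.exp (-(t / 4)) := by linarith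
  have hρ := armRightDensity_le_slope hlt
  rw [slope_def_field, show t + Real.exp (-(t / 4)) - t = Real.exp (-(t / 4)) by ring] at hρ
  have hk : 2 * (armFreeEnergy (t + Real.exp (-(t / 4))) - armFreeEnergy t) =
      (Real.log (armRate (Real.exp (t + Real.exp (-(t / 4)))) ^ 2) - (t + Real.exp (-(t / 4)))) -
        (Real.log (armRate (Real.exp t) ^ 2) - t) + Real.exp (-(t / 4)) := by
    rw [mul_sub, two_mul_armFreeEnergy_eq, two_mul_armFreeEnergy_eq]; ring
  have hU := log_armRate_sq_exp_sub_le (x := t + Real.exp (-(t / 4))) (by linarith)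
  have hL := le_log_armRate_sq_exp_sub ht
  -- `2Δκ ≤ h − 2hE + 7661 h²E + C h⁶E` with `E = e^{−2t}`
  have hk2 : 2 * (armFreeEnergy (t + Real.exp (-(t / 4))) - armFreeEnergy t) ≤
      Real.exp (-(t / 4)) - 2 * Real.exp (-(t / 4)) * Real.exp (-(2 * t)) +
        7661 * Real.exp (-(t / 4)) ^ 2 * Real.exp (-(2 * t)) + 58614341 * Real.exp (-(t / 4)) ^ 6 * Real.exp (-(2 * t)) := by
    rw [e5, e7] at hL
    rw [e5] at s5
    rw [hk]
    linear_combination hU + hL + s2 + 7655 * s5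
  -- divide by `h` and absorb `h⁴ ≤ 1/64`
  have hk3 : (armFreeEnergy (t + Real.exp (-(t / 4))) - armFreeEnergy t) / Real.exp (-(t / 4)) ≤
      1 / 2 - Real.exp (-(2 * t)) + 461756 * Real.exp (-(t / 4)) * Real.exp (-(2 * t)) := by
    rw [div_le_iff₀ hh0]
    have hp : Real.exp (-(t / 4)) ^ 6 * Real.exp (-(2 * t)) ≤ 1 / 64 * (Real.exp (-(t / 4)) ^ 2 * Real.exp (-(2 * t))) := by
      rw [show Real.exp (-(t / 4)) ^ 6 * Real.exp (-(2 * t)) = Real.exp (-(t / 4)) ^ 4 * (Real.exp (-(t / 4)) ^ 2 *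
        Real.exp (-(2 * t))) by ring]
      exact mul_le_mul_of_nonneg_right hh4 (by positivity)
    nlinarith [mul_pos hh0 hE, pow_pos hh0 2]
  rw [e9]
  linarith

set_option maxHeartbeats 400000 in
/-- ★★ **`1/2 − ρ⁻_rot(t) ≤ e^{−2t} + 488548·e^{−9t/4}` for `t ≥ log 64`**: `ρ⁻_rot(t)` is at least the slope of `κ_rot` over `[t − h, t]`,
`h = e^{−t/4}`, and `2(κ_rot(t) − κ_rot(t−h)) = L(t) − L(t−h) + h ≥ h − 2h e^{−2t} − 61246 h² e^{−2t} − 58614341 h⁶ e^{−2t}`.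
[cite: Beaton2014RotatedHoneycomb, §3.1 (arXiv v3 p. 11: log-convexity; p. 14: the density)] [cite: JansevanRensburg2000, §3.3 (densities as derivatives of the free energy)] -/
theorem half_sub_armLeftDensity_le_coeff {t : ℝ} (ht : Real.log 64 ≤ t) :
    1 / 2 - armLeftDensity t ≤ Real.exp (-(2 * t)) + 488548 * Real.exp (-(9 * t / 4)) := by
  obtain ⟨hh0, hh1, hh4, e5, e7, e9⟩ := quarter_step_facts ht
  obtain ⟨-, -, s2, s5⟩ := quarter_shift_facts t (Real.exp (-(t / 4))) hh0.le hh1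
  have hE : 0 < Real.exp (-(2 * t)) := Real.exp_pos _
  have ht4 : Real.log 16 ≤ t := (Real.log_le_log (by norm_num) (by norm_num)).trans ht
  have ht1 : 1 ≤ t := by
    have : (1 : ℝ) ≤ Real.log 16 := by
      rw [← Real.log_exp 1]
      exact Real.log_le_log (Real.exp_pos 1) (by have := Real.exp_one_lt_d9; norm_num at this ⊢; linarith)
    linarith
  -- the chord
  have hlt : t - Real.exp (-(t / 4)) < t := by linarith
  have hρ := slope_le_armLeftDensity hlt
  rw [slope_def_field, show t - (t - Real.exp (-(t / 4))) = Real.exp (-(t / 4)) by ring] at hρ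
  have hk : 2 * (armFreeEnergy t - armFreeEnergy (t - Real.exp (-(t / 4)))) =
      (Real.log (armRate (Real.exp t) ^ 2) - t) -
        (Real.log (armRate (Real.exp (t - Real.exp (-(t / 4)))) ^ 2) - (t - Real.exp (-(t / 4)))) + Real.exp (-(t / 4)) := by
    rw [mul_sub, two_mul_armFreeEnergy_eq, two_mul_armFreeEnergy_eq]; ring
  have hU := log_armRate_sq_exp_sub_le (x := t - Real.exp (-(t / 4))) (by linarith)
  have hL := le_log_armRate_sq_exp_sub ht
  have hk2 : Real.exp (-(t / 4)) - 2 * Real.exp (-(t / 4)) * Real.exp (-(2 * t)) -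
      61246 * Real.exp (-(t / 4)) ^ 2 * Real.exp (-(2 * t)) - 58614341 * Real.exp (-(t / 4)) ^ 6 * Real.exp (-(2 * t)) ≤
        2 * (armFreeEnergy t - armFreeEnergy (t - Real.exp (-(t / 4)))) := by
    rw [e5, e7] at hL
    rw [e5] at s5
    rw [hk]
    linear_combination hL + hU + s2 + 7655 * s5
  have hk3 : 1 / 2 - Real.exp (-(2 * t)) - 488548 * Real.exp (-(t / 4)) * Real.exp (-(2 * t)) ≤
      (armFreeEnergy t - armFreeEnergy (t - Real.exp (-(t / 4)))) / Real.exp (-(t / 4)) := by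
    rw [le_div_iff₀ hh0]
    have hp : Real.exp (-(t / 4)) ^ 6 * Real.exp (-(2 * t)) ≤ 1 / 64 * (Real.exp (-(t / 4)) ^ 2 * Real.exp (-(2 * t))) := by
      rw [show Real.exp (-(t / 4)) ^ 6 * Real.exp (-(2 * t)) = Real.exp (-(t / 4)) ^ 4 * (Real.exp (-(t / 4)) ^ 2 *
        Real.exp (-(2 * t))) by ring]
      exact mul_le_mul_of_nonneg_right hh4 (by positivity)
    nlinarith [mul_pos hh0 hE, pow_pos hh0 2]
  rw [e9]
  linarith

/-- ★★ **The armchair coefficient window**: for `t ≥ log 64`,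
`e^{−2t} − 461756 e^{−9t/4} ≤ 1/2 − ρ⁺_rot(t) ≤ 1/2 − ρ⁻_rot(t) ≤ e^{−2t} + 488548 e^{−9t/4}`.
[cite: Beaton2014RotatedHoneycomb, §3.1 (arXiv v3 pp. 11, 14)] [cite: JansevanRensburg2000, §3.3] -/
theorem armDensity_deficit_coeff_window {t : ℝ} (ht : Real.log 64 ≤ t) :
    Real.exp (-(2 * t)) - 461756 * Real.exp (-(9 * t / 4)) ≤ 1 / 2 - armRightDensity t ∧
      1 / 2 - armRightDensity t ≤ 1 / 2 - armLeftDensity t ∧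
      1 / 2 - armLeftDensity t ≤ Real.exp (-(2 * t)) + 488548 * Real.exp (-(9 * t / 4)) :=
  ⟨half_sub_armRightDensity_ge_coeff ht, by linarith [armLeftDensity_le_armRightDensity t], half_sub_armLeftDensity_le_coeff ht⟩

/-! ### §4  The armchair coefficient is ONE -/

/-- `e^{2t} · e^{−9t/4} = e^{−t/4} → 0`. [cite: MadrasSlade1993, §1.2] -/
theorem tendsto_exp_mul_exp_neg_nine_quarters :
    Tendsto (fun t : ℝ => Real.exp (2 * t) * Real.exp (-(9 * t / 4))) atTop (𝓝 0) := by
  have h : Tendsto (fun t : ℝ => Real.exp (-(t / 4))) atTop (𝓝 0) := by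
    have := Real.tendsto_exp_neg_atTop_nhds_zero.comp (tendsto_id.atTop_div_const (by norm_num : (0 : ℝ) < 4))
    exact this.congr fun t => by simp
  refine h.congr fun t => ?_
  rw [← Real.exp_add]; congr 1; ring

/-- ★★★ **THE ARMCHAIR DEFICIT COEFFICIENT IS ONE (right density): `e^{2t} (1/2 − ρ⁺_rot(t)) → 1`** — in the fugacity,
`y² (1/2 − ρ⁺_rot) → 1`. [cite: Beaton2014RotatedHoneycomb, §3.1 (arXiv v3 pp. 11, 14)] [cite: JansevanRensburg2000, §3.3] -/
theorem tendsto_exp_mul_half_sub_armRightDensity :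
    Tendsto (fun t : ℝ => Real.exp (2 * t) * (1 / 2 - armRightDensity t)) atTop (𝓝 1) := by
  have h0 := tendsto_exp_mul_exp_neg_nine_quarters
  have hlow : Tendsto (fun t : ℝ => 1 - 461756 * (Real.exp (2 * t) * Real.exp (-(9 * t / 4)))) atTop (𝓝 1) := by
    simpa using (h0.const_mul 461756).const_sub 1
  have hup : Tendsto (fun t : ℝ => 1 + 488548 * (Real.exp (2 * t) * Real.exp (-(9 * t / 4)))) atTop (𝓝 1) := by
    simpa using (h0.const_mul 488548).const_add 1
  refine tendsto_of_tendsto_of_tendsto_of_le_of_le' hlow hup ?_ ?_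
  · filter_upwards [eventually_ge_atTop (Real.log 64)] with t ht
    obtain ⟨h1, -, -⟩ := armDensity_deficit_coeff_window ht
    have he : Real.exp (2 * t) * Real.exp (-(2 * t)) = 1 := by rw [← Real.exp_add]; simp
    have := mul_le_mul_of_nonneg_left h1 (Real.exp_pos (2 * t)).le
    nlinarith [Real.exp_pos (2 * t)]
  · filter_upwards [eventually_ge_atTop (Real.log 64)] with t ht
    obtain ⟨-, h2, h3⟩ := armDensity_deficit_coeff_window ht
    have he : Real.exp (2 * t) * Real.exp (-(2 * t)) = 1 := by rw [← Real.exp_add]; simp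
    have := mul_le_mul_of_nonneg_left (h2.trans h3) (Real.exp_pos (2 * t)).le
    nlinarith [Real.exp_pos (2 * t)]

/-- ★★★ **THE ARMCHAIR DEFICIT COEFFICIENT IS ONE (left density): `e^{2t} (1/2 − ρ⁻_rot(t)) → 1`.**
[cite: Beaton2014RotatedHoneycomb, §3.1 (arXiv v3 pp. 11, 14)] [cite: JansevanRensburg2000, §3.3] -/
theorem tendsto_exp_mul_half_sub_armLeftDensity :
    Tendsto (fun t : ℝ => Real.exp (2 * t) * (1 / 2 - armLeftDensity t)) atTop (𝓝 1) := by
  have h0 := tendsto_exp_mul_exp_neg_nine_quarters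
  have hlow : Tendsto (fun t : ℝ => 1 - 461756 * (Real.exp (2 * t) * Real.exp (-(9 * t / 4)))) atTop (𝓝 1) := by
    simpa using (h0.const_mul 461756).const_sub 1
  have hup : Tendsto (fun t : ℝ => 1 + 488548 * (Real.exp (2 * t) * Real.exp (-(9 * t / 4)))) atTop (𝓝 1) := by
    simpa using (h0.const_mul 488548).const_add 1
  refine tendsto_of_tendsto_of_tendsto_of_le_of_le' hlow hup ?_ ?_
  · filter_upwards [eventually_ge_atTop (Real.log 64)] with t ht
    obtain ⟨h1, h2, -⟩ := armDensity_deficit_coeff_window ht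
    have he : Real.exp (2 * t) * Real.exp (-(2 * t)) = 1 := by rw [← Real.exp_add]; simp
    have := mul_le_mul_of_nonneg_left (h1.trans h2) (Real.exp_pos (2 * t)).le
    nlinarith [Real.exp_pos (2 * t)]
  · filter_upwards [eventually_ge_atTop (Real.log 64)] with t ht
    obtain ⟨-, -, h3⟩ := armDensity_deficit_coeff_window ht
    have he : Real.exp (2 * t) * Real.exp (-(2 * t)) = 1 := by rw [← Real.exp_add]; simp
    have := mul_le_mul_of_nonneg_left h3 (Real.exp_pos (2 * t)).le
    nlinarith [Real.exp_pos (2 * t)]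

/-- ★★ **`1/2 − ρ⁺_rot(t) ~ e^{−2t}`** (asymptotic equivalence). [cite: Beaton2014RotatedHoneycomb, §3.1 (arXiv v3 pp. 11, 14)] -/
theorem isEquivalent_half_sub_armRightDensity :
    (fun t : ℝ => 1 / 2 - armRightDensity t) ~[atTop] (fun t : ℝ => Real.exp (-(2 * t))) := by
  refine (isEquivalent_iff_tendsto_one ?_).2 ?_
  · exact Eventually.of_forall fun t => (Real.exp_pos _).ne'
  · refine tendsto_exp_mul_half_sub_armRightDensity.congr fun t => ?_
    rw [Pi.div_apply, Real.exp_neg, div_inv_eq_mul, mul_comm]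

/-- ★★ **`1/2 − ρ⁻_rot(t) ~ e^{−2t}`.** [cite: Beaton2014RotatedHoneycomb, §3.1 (arXiv v3 pp. 11, 14)] -/
theorem isEquivalent_half_sub_armLeftDensity :
    (fun t : ℝ => 1 / 2 - armLeftDensity t) ~[atTop] (fun t : ℝ => Real.exp (-(2 * t))) := by
  refine (isEquivalent_iff_tendsto_one ?_).2 ?_
  · exact Eventually.of_forall fun t => (Real.exp_pos _).ne'
  · refine tendsto_exp_mul_half_sub_armLeftDensity.congr fun t => ?_
    rw [Pi.div_apply, Real.exp_neg, div_inv_eq_mul, mul_comm]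

end Literature.Probability.RandomPlanarGeometry.SAW.HexBW.Arm
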